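import Summits.BirchSwinnertonDyer.BirchSwinnertonDyer.Theorems.CMKolyvaginAtInertTwoCMKolyvaginConjectureAtInertTwoTwoBitLawOfTwinShaTrivial
import HarnessLib

/-!
# Route `CMKolyvaginAtInertTwo`, crux `CMKolyvaginConjectureAtInertTwo` (stmt-BirchSwinnertonDyer-24648),
# stub `stub_positiveDepth` — THE TWIN-`Ш` LAWS IN THE STUB'S OWN CURRENCY, FRAME INPUTS DISCHARGED TO NAMED FACTS:
# binders of `stub_positiveDepth` + Kolyvagin's theorem + parity + Gross 3.7 (2) (by name) + `Ш(E^{(d_K)}/ℚ)[2^∞] = 0`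
# ⟹ every `w(E)`-signed Selmer class is `4`-torsion (no prime-level trigger at depth `≥ 2`), the first descent drops
# at most two bits at every deep prime, and a prime-level witness of the crux at depth `M₀ ≥ 3` has `M(ℓ) < M₀`

Seat `leafhand-bsd-cmkolyvaginatinert-10` g0 (cell `bsd-eis`); helper `--supports stmt-BirchSwinnertonDyer-24648`.
THEOREMS ONLY: no definition, no named fact introduced, no `sorry`; no stub, crux or summit closed; BSD is proved
for no curve.  File 4 of this seat (files 1–3: `…SelmerTriggerAnatomyOnGivenFrame`, `…SelmerTriggerTwinShaTrivialLaw`,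
`…TwoBitLawOfTwinShaTrivial`).

WHAT.  Files 2–3 display three frame inputs as binders: a conjugation `c ≠ 1`, the `ε`-line `hline`, and `w(E) = −1`.
On the frame of `stub_positiveDepth` all three are discharged, in hand 8's manner (`…EpsilonLineOnHTwo` §1/§3/§4):
`c` from `exists_algEquiv_ne_one_of_isImaginaryQuadratic`; the `ε`-line from Kolyvagin's theorem as the NAMED FACT
`kolyvagin N_E W K` (`isOfFinAddOrder_map_sub_smul_of_derivedPoint_one_of_kolyvagin`); `w(E) = −1` from `r_an(E) = 1` and
the parity NAMED FACT `even_analyticRank_iff_rootNumber_eq_one W` (bsd.S36; only `w ∈ {±1}` is used besides).  Results: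

* §1 `rootNumber_eq_neg_one_of_analyticRank_eq_one_of_parity` — `r_an(E) = 1` + bsd.S36 ⟹ `w(E) = −1` (two lines).
* §2 `four_zsmul_eq_zero_of_selmer_eigen_onStubFrame_of_twinShaTrivial` — binders of the stub (`ρ̄_{E,2}` onto,
  `r_an = 1`; `K` imaginary quadratic, Heegner; `Dt, β, ι`, `d₁` with `P(1)` of infinite order) + `kolyvagin` + bsd.S36 +
  `Ш(E^{(d_K)}/ℚ)[2^∞] = 0` ⟹ **every `s ∈ Sel_{2^M}(E/K)` with `c_* s = w(E)·s` has `4·s = 0`**; and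
  `pow_zsmul_eq_zero_of_selmer_eigen_onStubFrame_of_two_le_of_twinShaTrivial`: **`2^{M₀}·s = 0` for all `M₀ ≥ 2`** — the
  trigger of file 1 §1 does not exist on such frames at any depth `≥ 2`.
* §3 `exists_exactDepth_and_forall_pow_sub_two_dvd_onStubFrame_of_twinShaTrivial` — binders of the stub INCLUDING
  `2 ∣ P(1)` (positive depth), + Gross 3.7 (2) `prop37_2_reductionCongruence_inert N_E W K` + `kolyvagin` + bsd.S36 +
  `Ш(E^{(d_K)}/ℚ)[2^∞] = 0` ⟹ there is an EXACT depth `M₀ ≥ 1` such that for every `L ≥ M₀`, every Zhang–Kolyvagin prime `ℓ`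
  at `2` of index `≥ L` and every datum `e` of conductor `ℓ`: **`2^{M₀−2} ∣ P_e(ℓ)`** (hand 8 §4's shape, two bits for one,
  twin-`Ш`-trivial for `Ш(E/K) = ⊥`).
* §4 `kolyvaginIndex_lt_onStubFrame_of_not_two_dvd_of_twinShaTrivial` — same named facts, `2^{M₀} ∣ P(1)` with `M₀ ≥ 3`:
  **a prime-level witness `(ℓ, e)` of the crux (`P_e(ℓ) ∉ 2E(K[ℓ])`) has `Zhang2014.kolyvaginIndex W 2 ℓ < M₀`.**

HONEST FRAMING.  Conditional on two NAMED FACTS of the tree (`kolyvagin`, bsd.S36 — both published theorems, Kolyvagin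
1990 / the functional equation via modularity) and, in §3–§4, Gross 3.7 (2) by name; plus the twin hypothesis `hT0`.
Compositions of files 2–3 with hand 8's frame lemmas; nothing here touches the research core of `stub_positiveDepth`;
closes nothing; BSD is proved for no curve.
References: [cite: Kolyvagin1990, Thm. A] [cite: GrossLMS1991, §1 Thm. 1.3, Prop. 3.7 (2), §5 (5.1), Prop. 5.3]
[cite: SilvermanAEC2009, C.16 Thm. 16.3 and remark, p. 451] [cite: Kramer1981, Thm. 1] [cite: McCallumLMS1991, §5 Prop. 5.2, Thm. 5.4]
presearch: composition of tree theorems only (see files 1–3).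
-/

set_option autoImplicit false
set_option linter.dupNamespace false -- the Theorems namespace repeats the summit name by design (D-0017)

noncomputable section
open scoped Classical
open Field NumberField IsDedekindDomain Function WeierstrassCurve
open Literature.NumberTheory.EllipticCurves
open Literature.NumberTheory.EllipticCurves.ModularForms
open Literature.NumberTheory.GaloisRepresentations
open Literature.NumberTheory.GaloisCohomology
open Literature.NumberTheory.EllipticCurves.GrossLMS1991 (prop37_2_reductionCongruence_inert)
open Summit.BirchSwinnertonDyer.BirchSwinnertonDyer.Theorems.CMKolyvaginFirstDescentTwo
  (exists_algEquiv_ne_one_of_isImaginaryQuadratic isOfFinAddOrder_map_sub_smul_of_derivedPoint_one_of_kolyvagin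
    exists_exactDepth_pos)

namespace Summit.BirchSwinnertonDyer.BirchSwinnertonDyer.Theorems.CMKolyvaginFirstDescentTwoOnGivenFrame

variable (W : WeierstrassCurve ℚ) [W.IsElliptic] [W.IsGloballyMinimal] [NeZero (W.conductorNorm ℤ)]
  {K : Type} [Field K] [NumberField K]

/-! ## §1 `w(E) = −1` from `r_an(E) = 1` and parity -/

omit [W.IsGloballyMinimal] [NeZero (W.conductorNorm ℤ)] in
/-- **`r_an(E) = 1 ⟹ w(E) = −1`**, granted the parity fact bsd.S36 (`even_analyticRank_iff_rootNumber_eq_one W`: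
`r_an` even iff `w = 1`) and `w ∈ {±1}` (`rootNumber_eq_one_or`). [cite: SilvermanAEC2009, C.16 Thm. 16.3 and remark, p. 451] -/
theorem rootNumber_eq_neg_one_of_analyticRank_eq_one_of_parity (hpar : even_analyticRank_iff_rootNumber_eq_one W)
    (hr : W.analyticRank = 1) : W.rootNumber = -1 := by
  have h' : Even W.analyticRank ↔ W.rootNumber = 1 := hpar
  have h1 : ¬ Even W.analyticRank := by rw [hr]; exact Nat.not_even_one
  rcases W.rootNumber_eq_one_or with h | h
  · exact absurd (h'.mpr h) h1
  · exact h

/-! ## §2 No prime-level trigger at depth `≥ 2`, on the stub's frame -/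

/-- **On the frame of `stub_positiveDepth`, `Ш(E^{(d_K)}/ℚ)[2^∞] = 0 ⟹ 4·s = 0` for every `w(E)`-signed Selmer class.**
Binders: `ρ̄_{E,2}` onto, `r_an(E) = 1`; `K` imaginary quadratic, Heegner for `N_E`; `Dt, β, ι`, a conductor-`1` datum `d₁`
with `P(1)` of infinite order; the named facts `kolyvagin N_E W K` (for the `ε`-line) and bsd.S36 (for `w(E) = −1`); the
twin hypothesis `hT0`; a conjugation `c ≠ 1` (to state the eigen-condition); `s ∈ Sel_{2^M}(E/K)` with `c_* s = w(E)·s`.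
Then `4·s = 0` (file 2 §3 with hand 8's §3 `ε`-line). [cite: Kolyvagin1990, Thm. A] [cite: Kramer1981, Thm. 1]
[cite: GrossLMS1991, §5 (5.1), Prop. 5.3] -/
theorem four_zsmul_eq_zero_of_selmer_eigen_onStubFrame_of_twinShaTrivial (hρ2 : W.HasSurjectiveModNGaloisRep 2)
    (hr : W.analyticRank = 1) (hK : IsImaginaryQuadratic K) (hHe : SatisfiesHeegnerHypothesis (W.conductorNorm ℤ) K)
    (hKoly : kolyvagin (W.conductorNorm ℤ) W K) (hpar : even_analyticRank_iff_rootNumber_eq_one W)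
    (hT0 : ∀ x ∈ AddCommGroup.primaryComponent (↥(W.quadraticTwist (NumberField.discr K : ℚ)).sha) 2, x = 0)
    (Dt : ModularParametrizationData W (W.conductorNorm ℤ)) (β : ℤ) (ι : K →+* ℂ)
    (d₁ : KolyvaginHeegnerData Dt β ι 1) (hy : ¬ IsOfFinAddOrder d₁.derivedPoint)
    {c : K ≃ₐ[ℚ] K} (hc : c ≠ 1) {M : ℕ} {s : galH1Torsion (W.baseChange K) ((2 ^ M : ℕ) : ℤ)}
    (hs : s ∈ selmerGroup (W.baseChange K) ((2 ^ M : ℕ) : ℤ))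
    (hsν : conjAct W c ((2 ^ M : ℕ) : ℤ) s = W.rootNumber • s) :
    (((2 : ℕ) : ℤ) ^ 2) • s = 0 :=
  four_zsmul_eq_zero_of_selmer_eigen_of_twinShaTrivial W hρ2 hK hc hT0
    (rootNumber_eq_neg_one_of_analyticRank_eq_one_of_parity W hpar hr)
    (isOfFinAddOrder_map_sub_smul_of_derivedPoint_one_of_kolyvagin W hKoly hK hHe c hc Dt β ι d₁ hy) hs hsν

/-- **Hence `2^{M₀}·s = 0` for every `M₀ ≥ 2`** (same frame): the trigger of file 1 §1
(`exists_kolyvaginHeegnerData_not_two_dvd_of_exactDepth_of_selmerTrigger_pow`, `2^{M₀}·s ≠ 0`) does not exist on a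
twin-`Ш`-trivial frame of `stub_positiveDepth` at any depth `M₀ ≥ 2`. [cite: Kolyvagin1990, Thm. A] [cite: Kramer1981, Thm. 1] -/
theorem pow_zsmul_eq_zero_of_selmer_eigen_onStubFrame_of_two_le_of_twinShaTrivial
    (hρ2 : W.HasSurjectiveModNGaloisRep 2)
    (hr : W.analyticRank = 1) (hK : IsImaginaryQuadratic K) (hHe : SatisfiesHeegnerHypothesis (W.conductorNorm ℤ) K)
    (hKoly : kolyvagin (W.conductorNorm ℤ) W K) (hpar : even_analyticRank_iff_rootNumber_eq_one W)
    (hT0 : ∀ x ∈ AddCommGroup.primaryComponent (↥(W.quadraticTwist (NumberField.discr K : ℚ)).sha) 2, x = 0)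
    (Dt : ModularParametrizationData W (W.conductorNorm ℤ)) (β : ℤ) (ι : K →+* ℂ)
    (d₁ : KolyvaginHeegnerData Dt β ι 1) (hy : ¬ IsOfFinAddOrder d₁.derivedPoint)
    {c : K ≃ₐ[ℚ] K} (hc : c ≠ 1) {M : ℕ} {s : galH1Torsion (W.baseChange K) ((2 ^ M : ℕ) : ℤ)}
    (hs : s ∈ selmerGroup (W.baseChange K) ((2 ^ M : ℕ) : ℤ))
    (hsν : conjAct W c ((2 ^ M : ℕ) : ℤ) s = W.rootNumber • s) {M₀ : ℕ} (hM₀ : 2 ≤ M₀) :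
    (((2 : ℕ) : ℤ) ^ M₀) • s = 0 :=
  pow_zsmul_eq_zero_of_selmer_eigen_of_two_le_of_twinShaTrivial W hρ2 hK hc hT0
    (rootNumber_eq_neg_one_of_analyticRank_eq_one_of_parity W hpar hr)
    (isOfFinAddOrder_map_sub_smul_of_derivedPoint_one_of_kolyvagin W hKoly hK hHe c hc Dt β ι d₁ hy) hs hsν hM₀

/-! ## §3 The two-bit law in the stub's currency -/

/-- **ON A TWIN-`Ш`-TRIVIAL FRAME OF `stub_positiveDepth` THE FIRST DESCENT DROPS AT MOST TWO BITS — modulo three named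
facts.**  Binders of the stub (`ρ̄_{E,2}` onto, `r_an = 1`, odd Tamagawa product; `K` imaginary quadratic with odd
`d_K ≠ −3`, Heegner for `N_E`; `Dt, β, ι`, a conductor-`1` datum `d₁` with `P(1)` of infinite order and `2 ∣ P(1)`), Gross's
Prop. 3.7 (2) as `prop37_2_reductionCongruence_inert N_E W K`, Kolyvagin's theorem as `kolyvagin N_E W K`, parity bsd.S36, and
`Ш(E^{(d_K)}/ℚ)[2^∞] = 0`.  Then there is an EXACT depth `M₀ ≥ 1` (`2^{M₀} ∥ P(1)` in `E(K[1])`) such that for every `L ≥ M₀`,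
every Zhang–Kolyvagin prime `ℓ` at `2` of index `≥ L` and every datum `e` of conductor `ℓ`: **`2^{M₀−2} ∣ P_e(ℓ)` in
`E(K[ℓ])`** (file 3 §1; at `M₀ = 1` the claim is empty).  Compare hand 8's §4 (`Ш(E/K)[2^∞] = ⊥ ⟹ 2^{M₀−1} ∣ P_e(ℓ)`).
[cite: McCallumLMS1991, §5 (Prop. 5.2, Thm. 5.4)] [cite: GrossLMS1991, Prop. 3.7 (2), §5 Prop. 5.3, §1 Thm. 1.3]
[cite: Kramer1981, Thm. 1] -/
theorem exists_exactDepth_and_forall_pow_sub_two_dvd_onStubFrame_of_twinShaTrivial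
    (hρ2 : W.HasSurjectiveModNGaloisRep 2) (hr : W.analyticRank = 1) (hT : Odd W.tamagawaProduct)
    (hK : IsImaginaryQuadratic K) (hodd : Odd (NumberField.discr K)) (h3 : NumberField.discr K ≠ -3)
    (hHe : SatisfiesHeegnerHypothesis (W.conductorNorm ℤ) K)
    (h37 : prop37_2_reductionCongruence_inert (W.conductorNorm ℤ) W K)
    (hKoly : kolyvagin (W.conductorNorm ℤ) W K) (hpar : even_analyticRank_iff_rootNumber_eq_one W)
    (hT0 : ∀ x ∈ AddCommGroup.primaryComponent (↥(W.quadraticTwist (NumberField.discr K : ℚ)).sha) 2, x = 0)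
    (Dt : ModularParametrizationData W (W.conductorNorm ℤ)) (β : ℤ) (ι : K →+* ℂ)
    (d₁ : KolyvaginHeegnerData Dt β ι 1) (hy : ¬ IsOfFinAddOrder d₁.derivedPoint)
    (hpos : ∃ Q : (W.baseChange (ringClassField K ι 1)).toAffine.Point, (2 : ℤ) • Q = d₁.derivedPoint) :
    ∃ M₀ : ℕ, 1 ≤ M₀ ∧
      (∃ Q : (W.baseChange (ringClassField K ι 1)).toAffine.Point, ((2 ^ M₀ : ℕ) : ℤ) • Q = d₁.derivedPoint) ∧
      (¬ ∃ Q : (W.baseChange (ringClassField K ι 1)).toAffine.Point,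
        ((2 ^ (M₀ + 1) : ℕ) : ℤ) • Q = d₁.derivedPoint) ∧
      ∀ (L : ℕ), M₀ ≤ L → ∀ (ℓ : ℕ), Zhang2014.IsKolyvaginPrime (W.conductorNorm ℤ) W K 2 ℓ →
        L ≤ Zhang2014.kolyvaginIndex W 2 ℓ → ∀ e : KolyvaginHeegnerData Dt β ι ℓ,
          ∃ Q : (W.baseChange (ringClassField K ι ℓ)).toAffine.Point,
            ((2 ^ (M₀ - 2) : ℕ) : ℤ) • Q = e.derivedPoint := by
  obtain ⟨c, hc⟩ := exists_algEquiv_ne_one_of_isImaginaryQuadratic hK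
  have hw := rootNumber_eq_neg_one_of_analyticRank_eq_one_of_parity W hpar hr
  have hline := isOfFinAddOrder_map_sub_smul_of_derivedPoint_one_of_kolyvagin W hKoly hK hHe c hc Dt β ι d₁ hy
  obtain ⟨M₀, hM₀, hdiv, hndiv⟩ := exists_exactDepth_pos W hK Dt β ι d₁ hy hpos
  refine ⟨M₀, hM₀, hdiv, hndiv, fun L hML ℓ hKol hidx e ↦ ?_⟩
  rcases Nat.lt_or_ge M₀ 2 with h1 | h2
  · -- `M₀ = 1`: `2^{M₀−2} = 1`, nothing to prove
    refine ⟨e.derivedPoint, ?_⟩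
    rw [show M₀ - 2 = 0 by omega, pow_zero, Nat.cast_one, one_smul]
  · exact pow_sub_two_dvd_derivedPoint_of_twinShaTrivial W hρ2 hT hK hodd h3 hHe h37 hc hline hw hT0 Dt β ι d₁ h2
      hML hdiv hKol hidx e

/-! ## §4 A prime-level witness is shallow relative to the depth, in the stub's currency -/

/-- **ON A TWIN-`Ш`-TRIVIAL FRAME OF `stub_positiveDepth` WITH `2^{M₀} ∣ P(1)`, `M₀ ≥ 3`, A PRIME-LEVEL WITNESS OF THE CRUX
HAS KOLYVAGIN INDEX `< M₀` — modulo the same three named facts.**  If `ℓ` is a Zhang–Kolyvagin prime at `2` and a datum `e`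
of conductor `ℓ` has `P_e(ℓ) ∉ 2E(K[ℓ])` (the conclusion of `CMKolyvaginConjectureAtInertTwo` at `n = ℓ`), then
`Zhang2014.kolyvaginIndex W 2 ℓ < M₀` (file 3 §3, frame inputs discharged).
[cite: McCallumLMS1991, §5 (Prop. 5.2, Thm. 5.4)] [cite: WZhang2014, §3.7 (M(ℓ), Λ)] [cite: Kramer1981, Thm. 1] -/
theorem kolyvaginIndex_lt_onStubFrame_of_not_two_dvd_of_twinShaTrivial
    (hρ2 : W.HasSurjectiveModNGaloisRep 2) (hr : W.analyticRank = 1) (hT : Odd W.tamagawaProduct)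
    (hK : IsImaginaryQuadratic K) (hodd : Odd (NumberField.discr K)) (h3 : NumberField.discr K ≠ -3)
    (hHe : SatisfiesHeegnerHypothesis (W.conductorNorm ℤ) K)
    (h37 : prop37_2_reductionCongruence_inert (W.conductorNorm ℤ) W K)
    (hKoly : kolyvagin (W.conductorNorm ℤ) W K) (hpar : even_analyticRank_iff_rootNumber_eq_one W)
    (hT0 : ∀ x ∈ AddCommGroup.primaryComponent (↥(W.quadraticTwist (NumberField.discr K : ℚ)).sha) 2, x = 0)
    (Dt : ModularParametrizationData W (W.conductorNorm ℤ)) (β : ℤ) (ι : K →+* ℂ)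
    (d₁ : KolyvaginHeegnerData Dt β ι 1) (hy : ¬ IsOfFinAddOrder d₁.derivedPoint) {M₀ : ℕ} (hM₀ : 3 ≤ M₀)
    (hdiv : ∃ Q : (W.baseChange (ringClassField K ι 1)).toAffine.Point,
      ((2 ^ M₀ : ℕ) : ℤ) • Q = d₁.derivedPoint)
    {ℓ : ℕ} (hKol : Zhang2014.IsKolyvaginPrime (W.conductorNorm ℤ) W K 2 ℓ) (e : KolyvaginHeegnerData Dt β ι ℓ)
    (hP : ¬ ∃ Q : (W.baseChange (ringClassField K ι ℓ)).toAffine.Point, (2 : ℤ) • Q = e.derivedPoint) :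
    Zhang2014.kolyvaginIndex W 2 ℓ < M₀ := by
  obtain ⟨c, hc⟩ := exists_algEquiv_ne_one_of_isImaginaryQuadratic hK
  exact kolyvaginIndex_lt_of_not_two_dvd_of_twinShaTrivial W hρ2 hT hK hodd h3 hHe h37 hc
    (isOfFinAddOrder_map_sub_smul_of_derivedPoint_one_of_kolyvagin W hKoly hK hHe c hc Dt β ι d₁ hy)
    (rootNumber_eq_neg_one_of_analyticRank_eq_one_of_parity W hpar hr) hT0 Dt β ι d₁ hM₀ hdiv hKol e hP

end Summit.BirchSwinnertonDyer.BirchSwinnertonDyer.Theorems.CMKolyvaginFirstDescentTwoOnGivenFrame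

end
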